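import Mathlib
import Summits.ValiantsHypothesis.ValiantsHypothesis.Theorems.RigidityForcesSymmetryRankRigidMinimalReprLaplaceFiveSeparatedCaptureEqualSpansK1

/-!
# ValiantsHypothesis / RigidityForcesSymmetry — crux `LaplaceOptimalFive` (stmt-ValiantsHypothesis-24813), young-shadow K1:
# **THE LOCAL (SC) ⇒ K1 BRIDGE ON `K₃ ⊔ K₂`** (tool file)

The global bridge ✓ `sideSym_K32canon_of_symCapture` (val-lit-p4 g17) turns the OPEN symmetric capture inequality `CaptureIneqSym`
(quantified over ALL triples of symmetric configuration spaces `U₀₁, U₀₂, U₁₂`) into K1 on the canonical `K₃ ⊔ K₂ = {01, 02, 12, 34}`.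
Its proof uses the inequality at ONE triple only: the three triangle short spans `shortSpan T S u 0 1`, `shortSpan T S u 0 2`,
`shortSpan T S u 1 2` of the decomposition at hand, with `W` the image of the leaf kernel.  This file states that LOCAL form once and
for all, so that every kernel sub-case of (SC) (✓ monomial spans, ✓ equal spans, ✓ lines, ✓ two cuts, …) becomes a short K1 corollary
instead of a re-derivation of steps (0)–(5) of ✓ `sideSym_K32canon_equalLines` / ✓ `sideSym_K32canon_equalSpans`:

* `shortSpan_symm_of_sideSymmetric` — under `SideSymmetric`, the short span on any pair cut `{a, b} ≠ {3, 4}`… in fact on ANY pair cut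
  filed in `T` consists of symmetric matrices (✓ `shortSpan_symm` + ✓ `swap_inv_of_slotInvariantOn`).
* ★ `separated_of_captureAt` — cylindrical + exact + `{3,4}`-separated pair profile + the capture inequality AT the three actual
  triangle short spans ⇒ weight `≥ 120` (proof = ✓ `separated_of_symCapture` verbatim with the global hypothesis replaced by the local
  one; no slot symmetry is needed in this form).
* ★ `sideSym_K32canon_of_captureAt` — the same for a side-symmetric split decomposition on `{01, 02, 12, 34}`; here the local capture
  hypothesis is offered the symmetry of the three short spans as antecedents (discharged from `SideSymmetric`), which is what the
  (SC)-sector theorems consume.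
* `sideSym_K32canon_of_symCapture'` — sanity: the global bridge is the special case `hcap := CaptureIneqSym` (one line).

Honest framing.  A TOOL (restructuring of a landed proof); it proves no new case of K1.  K1 on `K₃ ⊔ K₂` in general, `CaptureIneqSym`,
S2′, `LaplaceOptimalFive` (OPEN · CONTESTED 72/120), `RankRigidMinimalRepr`, `VP ≠ VNP` are NOT proved.  No definitions, no `sorry`.
-/

set_option linter.dupNamespace false
set_option autoImplicit false

namespace Summit.ValiantsHypothesis.ValiantsHypothesis.Theorems.RigidityForcesSymmetryRankRigidMinimalRepr

namespace LaplaceFiveSeparatedCapture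

open Finset LaplaceFiveSectorSplit

/-- Under `SideSymmetric`, the short span on a pair cut `{a, b}` (`a ≠ b`) consists of symmetric matrices: every short factor filed
on that cut is slot-invariant on `{a, b}`, hence invariant under the transposition `(a b)` (✓ `swap_inv_of_slotInvariantOn`), and
✓ `shortSpan_symm` applies. [folklore] -/
theorem shortSpan_symm_of_sideSymmetric {N : ℕ} (T : Finset (Fin N)) (S : Fin N → Finset (Fin 5))
    (u w : Fin N → (Fin 5 → Fin 5) → ℂ) (hsym : SideSymmetric T S u w) (a b : Fin 5) (hab : a ≠ b) :
    ∀ x ∈ shortSpan T S u a b, ∀ p q : Fin 5, x p q = x q p := by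
  refine shortSpan_symm T S u a b hab fun t ht hSt v => ?_
  have hinv := (hsym t ht).1
  rw [hSt] at hinv
  exact swap_inv_of_slotInvariantOn (u t) a b hinv v

set_option maxHeartbeats 1600000 in
/-- ★ **LOCAL CAPTURE ⇒ weight `≥ 120`.**  For an exact cylindrical system on a `{3,4}`-separated pair profile (leaf short factors and
all long factors arbitrary; any multiplicities; off-shell allowed): if every space `W` of symmetric zero-diagonal leaf matrices whose
obligations are captured by `L3` OF THE THREE ACTUAL TRIANGLE SHORT SPANS satisfies
`dim W ≤ dim (shortSpan 0 1) + dim (shortSpan 0 2) + dim (shortSpan 1 2)`, then the Laplace weight is `≥ 5! = 120`.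
Proof = ✓ `separated_of_symCapture` with its one use of `CaptureIneqSym` replaced by the local hypothesis: the captured leaf space has
dimension `≥ 10 − n₃₄` (rank–nullity for the leaf evaluation map on the `10` coordinates of symmetric zero-diagonal matrices and
✓ `stub_obligation_captured`), each span has dimension `≤` the number of terms on its cut, so `|T| ≥ 10` and the weight is `12·|T|`.
[folklore] -/
theorem separated_of_captureAt {N : ℕ} (T : Finset (Fin N)) (S : Fin N → Finset (Fin 5))
    (u w : Fin N → (Fin 5 → Fin 5) → ℂ) (hc : Cylindrical S u w)
    (hex : ∀ v : Fin 5 → Fin 5, (∑ t ∈ T, u t v * w t v) = perm5 v) (hsep : SepProfile34 T S)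
    (hcap : ∀ W : Submodule ℂ (Fin 5 → Fin 5 → ℂ),
      (∀ μ ∈ W, ∀ s t : Fin 5, μ s t = μ t s) → (∀ μ ∈ W, ∀ s : Fin 5, μ s s = 0) →
      (∀ μ ∈ W, contractZ μ ∈ L3 (shortSpan T S u 0 1) (shortSpan T S u 0 2) (shortSpan T S u 1 2)) →
      Module.finrank ℂ W ≤ Module.finrank ℂ (shortSpan T S u 0 1) + Module.finrank ℂ (shortSpan T S u 0 2)
        + Module.finrank ℂ (shortSpan T S u 1 2)) :
    Nat.factorial 5 ≤ laplaceWeight T S := by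
  classical
  /- (1) the profile is made of pair cuts: weight = 12·|T| and the four cut classes are disjoint in T -/
  have hweight : laplaceWeight T S = 12 * T.card := by
    unfold laplaceWeight
    rw [Finset.sum_congr rfl (g := fun _ => 12) ?_]
    · simp [mul_comm]
    · intro t ht
      rcases hsep t ht with h | h | h | h <;> rw [h] <;> decide
  have hcount :
      (T.filter (fun t => S t = ({0, 1} : Finset (Fin 5)))).card
        + (T.filter (fun t => S t = ({0, 2} : Finset (Fin 5)))).card
        + (T.filter (fun t => S t = ({1, 2} : Finset (Fin 5)))).card
        + (T.filter (fun t => S t = ({3, 4} : Finset (Fin 5)))).card ≤ T.card := by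
    rw [Finset.card_filter, Finset.card_filter, Finset.card_filter, Finset.card_filter,
      ← Finset.sum_add_distrib, ← Finset.sum_add_distrib, ← Finset.sum_add_distrib, Finset.card_eq_sum_ones T]
    apply Finset.sum_le_sum
    intro t ht
    rcases hsep t ht with h | h | h | h <;> rw [h] <;> decide
  /- (2) spans are at most as big as the number of terms on the cut -/
  have hn01 := finrank_shortSpan_le_card T S u 0 1
  have hn02 := finrank_shortSpan_le_card T S u 0 2
  have hn12 := finrank_shortSpan_le_card T S u 1 2
  /- (3) coordinates for the symmetric zero-diagonal leaf matrices: an injective linear chart from ℂ^{10} -/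
  let P' := {x : Fin 5 × Fin 5 // x.1 < x.2}
  have hP : Fintype.card P' = 10 := by decide
  let LsymFun : (P' → ℂ) → (Fin 5 → Fin 5 → ℂ) := fun c s t =>
    if h : s < t then c ⟨(s, t), h⟩ else if h' : t < s then c ⟨(t, s), h'⟩ else 0
  let Lsym : (P' → ℂ) →ₗ[ℂ] (Fin 5 → Fin 5 → ℂ) :=
    { toFun := LsymFun
      map_add' := by
        intro c c'
        funext s t
        simp only [LsymFun, Pi.add_apply]
        split_ifs <;> simp
      map_smul' := by
        intro r c
        funext s t
        simp only [LsymFun, Pi.smul_apply, smul_eq_mul, RingHom.id_apply]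
        split_ifs <;> simp }
  have hLsym_apply : ∀ c s t, Lsym c s t = LsymFun c s t := fun _ _ _ => rfl
  have hinj : Function.Injective Lsym := by
    intro c c' h
    funext π
    have := congr_fun (congr_fun h π.1.1) π.1.2
    simpa [hLsym_apply, LsymFun, π.2] using this
  have hsymL : ∀ c (s t : Fin 5), Lsym c s t = Lsym c t s := by
    intro c s t
    simp only [hLsym_apply, LsymFun]
    rcases lt_trichotomy s t with h | rfl | h
    · simp [h, not_lt.mpr h.le]
    · simp
    · simp [h, not_lt.mpr h.le]
  have hdiag : ∀ c (s : Fin 5), Lsym c s s = 0 := by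
    intro c s
    simp [hLsym_apply, LsymFun]
  /- (4) the leaf evaluation map and its kernel (rank–nullity: dim ker ≥ 10 − n₃₄) -/
  let ev : (Fin 5 → Fin 5 → ℂ) →ₗ[ℂ] ((T.filter (fun t => S t = ({3, 4} : Finset (Fin 5)))) → ℂ) :=
    { toFun := fun M t => ∑ s : Fin 5, ∑ s' : Fin 5, M s s' * short2 (u t.1) 3 4 s s'
      map_add' := by
        intro M M'
        funext t
        simp only [Pi.add_apply, add_mul, Finset.sum_add_distrib]
      map_smul' := by
        intro r M
        funext t
        simp only [Pi.smul_apply, smul_eq_mul, RingHom.id_apply, Finset.mul_sum, mul_assoc] }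
  have hev_apply : ∀ M t, ev M t = ∑ s : Fin 5, ∑ s' : Fin 5, M s s' * short2 (u t.1) 3 4 s s' :=
    fun _ _ => rfl
  let ev' : (P' → ℂ) →ₗ[ℂ] ((T.filter (fun t => S t = ({3, 4} : Finset (Fin 5)))) → ℂ) := ev ∘ₗ Lsym
  have hrn := LinearMap.finrank_range_add_finrank_ker ev'
  rw [Module.finrank_fintype_fun_eq_card, hP] at hrn
  have hrange : Module.finrank ℂ (LinearMap.range ev')
      ≤ (T.filter (fun t => S t = ({3, 4} : Finset (Fin 5)))).card := by
    have := Submodule.finrank_le (LinearMap.range ev')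
    rwa [Module.finrank_fintype_fun_eq_card, Fintype.card_coe] at this
  /- (5) the captured space W := Lsym (ker ev') and the LOCAL capture inequality -/
  have hWK : Module.finrank ℂ ((LinearMap.ker ev').map Lsym) = Module.finrank ℂ (LinearMap.ker ev') :=
    (LinearEquiv.finrank_eq (Submodule.equivMapOfInjective Lsym hinj (LinearMap.ker ev'))).symm
  have hcapW : Module.finrank ℂ ((LinearMap.ker ev').map Lsym)
      ≤ Module.finrank ℂ (shortSpan T S u 0 1) + Module.finrank ℂ (shortSpan T S u 0 2)
        + Module.finrank ℂ (shortSpan T S u 1 2) := by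
    apply hcap
    · intro μ hμ s t
      obtain ⟨c, -, rfl⟩ := Submodule.mem_map.1 hμ
      exact hsymL c s t
    · intro μ hμ s
      obtain ⟨c, -, rfl⟩ := Submodule.mem_map.1 hμ
      exact hdiag c s
    · intro μ hμ
      obtain ⟨c, hcK, rfl⟩ := Submodule.mem_map.1 hμ
      apply stub_obligation_captured N T S u w hc hex hsep
      intro t ht h34
      have h0 := congr_fun (LinearMap.mem_ker.1 hcK) ⟨t, Finset.mem_filter.2 ⟨ht, h34⟩⟩
      rw [Pi.zero_apply] at h0
      simpa [ev', hev_apply] using h0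
  /- (6) count -/
  have h5 : Nat.factorial 5 = 120 := by decide
  rw [h5, hweight]
  omega

/-- ★ **THE LOCAL (SC) ⇒ K1 BRIDGE ON THE CANONICAL `K₃ ⊔ K₂ = {01, 02, 12, 34}`.**  A side-symmetric split decomposition of `P₅`
supported on the triangle `{0,1}, {0,2}, {1,2}` plus the disjoint edge `{3,4}` has Laplace weight `≥ 5! = 120` as soon as the symmetric
capture inequality holds AT ITS OWN three triangle short spans — the hypothesis `hcap` receives the symmetry of the three spans
(consequences of `SideSymmetric`, ✓ `shortSpan_symm_of_sideSymmetric`) as antecedents, so a consumer only supplies the (SC)-sector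
theorem applied to `shortSpan T S u 0 1 / 0 2 / 1 2`. [folklore] -/
theorem sideSym_K32canon_of_captureAt {N : ℕ} (T : Finset (Fin N)) (S : Fin N → Finset (Fin 5))
    (u w : Fin N → (Fin 5 → Fin 5) → ℂ) (hdec : IsSplitDecomposition T S u w) (hsym : SideSymmetric T S u w)
    (hC : ∀ t ∈ T, S t = ({0, 1} : Finset (Fin 5)) ∨ S t = ({0, 2} : Finset (Fin 5)) ∨
      S t = ({1, 2} : Finset (Fin 5)) ∨ S t = ({3, 4} : Finset (Fin 5)))
    (hcap : (∀ x ∈ shortSpan T S u 0 1, ∀ p q : Fin 5, x p q = x q p) →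
      (∀ x ∈ shortSpan T S u 0 2, ∀ p q : Fin 5, x p q = x q p) →
      (∀ x ∈ shortSpan T S u 1 2, ∀ p q : Fin 5, x p q = x q p) →
      ∀ W : Submodule ℂ (Fin 5 → Fin 5 → ℂ),
      (∀ μ ∈ W, ∀ s t : Fin 5, μ s t = μ t s) → (∀ μ ∈ W, ∀ s : Fin 5, μ s s = 0) →
      (∀ μ ∈ W, contractZ μ ∈ L3 (shortSpan T S u 0 1) (shortSpan T S u 0 2) (shortSpan T S u 1 2)) →
      Module.finrank ℂ W ≤ Module.finrank ℂ (shortSpan T S u 0 1) + Module.finrank ℂ (shortSpan T S u 0 2)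
        + Module.finrank ℂ (shortSpan T S u 1 2)) :
    Nat.factorial 5 ≤ laplaceWeight T S := by
  refine separated_of_captureAt T S u w ⟨hdec.1, hdec.2.1⟩ (fun v => ?_) hC
    (hcap (shortSpan_symm_of_sideSymmetric T S u w hsym 0 1 (by decide))
      (shortSpan_symm_of_sideSymmetric T S u w hsym 0 2 (by decide))
      (shortSpan_symm_of_sideSymmetric T S u w hsym 1 2 (by decide)))
  rw [hdec.2.2 v]
  rfl

/-- Sanity / compatibility: the global bridge ✓ `sideSym_K32canon_of_symCapture` is the special case in which the local hypothesis is
supplied by the global `CaptureIneqSym`. [folklore] -/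
theorem sideSym_K32canon_of_symCapture' (hcap : CaptureIneqSym) {N : ℕ} (T : Finset (Fin N)) (S : Fin N → Finset (Fin 5))
    (u w : Fin N → (Fin 5 → Fin 5) → ℂ) (hdec : IsSplitDecomposition T S u w) (hsym : SideSymmetric T S u w)
    (hC : ∀ t ∈ T, S t = ({0, 1} : Finset (Fin 5)) ∨ S t = ({0, 2} : Finset (Fin 5)) ∨
      S t = ({1, 2} : Finset (Fin 5)) ∨ S t = ({3, 4} : Finset (Fin 5))) :
    Nat.factorial 5 ≤ laplaceWeight T S :=
  sideSym_K32canon_of_captureAt T S u w hdec hsym hC fun h01 h02 h12 W hWs hWd hWc =>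
    hcap _ _ _ W h01 h02 h12 hWs hWd hWc

end LaplaceFiveSeparatedCapture

end Summit.ValiantsHypothesis.ValiantsHypothesis.Theorems.RigidityForcesSymmetryRankRigidMinimalRepr
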